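import Summits.Langlands.Langlands.Theses.ParityBlindBianchi
import Summits.Langlands.Langlands.Theorems.ParityBlindBianchiResidualBianchiDoorMod2TwoAdicModel
import Summits.Langlands.Langlands.Theorems.ParityBlindBianchiResidualBianchiDoorMod2SerreKW
import Literature.NumberTheory.Automorphic.BaseChangeCyclicCuspidal
import Literature.NumberTheory.Automorphic.BaseChangeStrongAllFinite
import Literature.NumberTheory.Automorphic.BaseChangeArchimedeanProofs
import Summits.Langlands.Langlands.Theorems.PhantomRMYoshidaSerreKWAutomorphicGL2
import Literature.NumberTheory.GaloisRepresentations.GaloisRepFrobeniusProofs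
import Summits.Langlands.Langlands.Theorems.ParityBlindBianchiResidualBianchiDoorLevelDictionaryC
import Summits.Langlands.Langlands.Theorems.ParityBlindBianchiResidualBianchiDoorLevelQLevel
import Summits.Langlands.Langlands.Theorems.ParityBlindBianchiResidualBianchiDoorLevelCuspWitness
import Summits.Langlands.Langlands.Theorems.ParityBlindBianchiResidualBianchiDoorLevelBcTransfer
import Summits.Langlands.Langlands.Theorems.ParityBlindBianchiResidualBianchiDoorLevelResidual
import Summits.Langlands.Langlands.Theorems.ParityBlindBianchiResidualBianchiDoorLevelPredictedPolyCongr
import HarnessLib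

/-!
# Line `Sketch` (card `serrekw-ctwist-strong-bc`) for crux `ParityBlindBianchi.ResidualBianchiDoorLevel`
# (item stmt-Langlands-15112) — lead skeleton

E1′ = (a K-free ℚ-level congruence package in the C-normalisation `m = 2`, from Khare–Wintenberger at
`p = 2` through the landed SerreKW stubs; every a.e. exception absorbed into `S`, chosen after `(ρ, ι)`
and before `K`) + (a uniform-in-`K` strong quadratic base-change transfer, whose one input beyond the
tree's older facts is Arthur–Clozel Thm 5.1 at ALL finite places,
`ArthurClozel1989_strongLifting_allFinite`, vendored since as p91658).

Stubs (sorried here, each landed as its own Theorems file `--supports stmt-Langlands-15112`):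
* `stub_dictionaryC` — the C-normalised twin of the landed `stub_dictionaryL`: `π ⊗ ε⁻¹` (no norm
  twist) is REGULAR ALGEBRAIC for even weight and has Satake multiset `{(√q)^{k-1}/β}` a.e.;
* `stub_predictedPolyCongr` — `arithFrobPolyOfSatake ι q 2` of that multiset is congruent
  coefficientwise (in `𝔪_{ℤ̄₂}`) to `ι⁻¹` of the Hecke polynomial, for `q` odd (`ι⁻¹√q ≡ 1`);
* `stub_residual` — integral model over `ℤ̄₂` and reduction of a finite-image `σ₀ : Γ_ℚ → GL₂(ℚ̄₂)`
  with projective image `A₅`: an IRREDUCIBLE continuous `σ̄ : Γ_ℚ → GL₂(k)` with integral split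
  characteristic polynomials reducing to those of `σ̄`;
* `stub_qLevel` (lead) — the ℚ-level package from `khare_wintenberger`;
* `stub_cuspWitness` — for every quadratic `K`, an inert good place with `α ≠ -α` (Chebotarev);
* `stub_bcTransfer` — the K-side transfer from the three base-change facts.
Composition `ResidualBianchiDoorLevel_of` is sorry-free modulo the stubs.

FINAL STATE (2026-08-16): all six obligation stubs LANDED (p97568 p97902 p98183 p99921 p98028 p101192) and the
conditional assembly `ResidualBianchiDoorLevel_of_facts (hKW) (hBC) (hArch) (hR1)` LANDED as
`Summits/Langlands/Langlands/Theorems/ParityBlindBianchiResidualBianchiDoorLevel.lean` (p103446); the only `sorry` left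
here is `stub_namedFacts` = the four named facts (not an obligation).
-/

noncomputable section

namespace Summit.Langlands.Langlands.Cruxes.ResidualBianchiDoorLevel.Sketch

set_option linter.dupNamespace false

-- (H5) `mixedSpace ℚ` needs classical `Fintype` instances on the place subtypes (as in `AdelicGLnGlue`).
open scoped MatrixGroups Polynomial Valued Classical
open Polynomial NumberField IsDedekindDomain Filter CongruenceSubgroup
open Literature.NumberTheory.Automorphic Literature.NumberTheory.GaloisRepresentations
  Literature.NumberTheory.EllipticCurves.ModularForms

/-! ## ℚ-side stubs -/

-- `stub_dictionaryC`: LANDED (p97568) — imported from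
-- `Summits.Langlands.Langlands.Theorems.ParityBlindBianchiResidualBianchiDoorLevelDictionaryC`.

-- `stub_predictedPolyCongr`: LANDED (p97902) — imported from
-- `Summits.Langlands.Langlands.Theorems.ParityBlindBianchiResidualBianchiDoorLevelPredictedPolyCongr`.

-- `stub_residual`: LANDED (p98183) — imported from
-- `Summits.Langlands.Langlands.Theorems.ParityBlindBianchiResidualBianchiDoorLevelResidual`.

-- `stub_qLevel` (lead): LANDED (p101192) — imported from
-- `Summits.Langlands.Langlands.Theorems.ParityBlindBianchiResidualBianchiDoorLevelQLevel`.

/-! ## K-side stubs -/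

-- `stub_cuspWitness`: LANDED (p99921) — imported from
-- `Summits.Langlands.Langlands.Theorems.ParityBlindBianchiResidualBianchiDoorLevelCuspWitness`.

-- `stub_bcTransfer`: LANDED (p98028) — imported from
-- `Summits.Langlands.Langlands.Theorems.ParityBlindBianchiResidualBianchiDoorLevelBcTransfer`.

/-! ## The named-fact inputs (NOT a proof obligation) -/

/-- **Stub `stub_namedFacts` (NAMED-FACT INPUTS, not a proof obligation; nobody is asked to prove it).**
The four unproved published inputs of the line, EXACTLY as vendored in the tree: Serre's modularity
conjecture in the Khare–Wintenberger form (`khare_wintenberger p k`, all `p`, `k`; only `p = 2` is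
used), Arthur–Clozel Ch. 3 Thm 4.2 (a) (`baseChange_cyclic_cuspidal`), Thm 5.1 at the archimedean
places (`ArthurClozel1989_strongLifting_archimedean`) and Thm 5.1 at all finite places
(`ArthurClozel1989_strongLifting_allFinite`, p91658).  Registered as ONE stub only because the
skeleton audit admits no named-fact hypothesis on `ResidualBianchiDoorLevel_of`; the lead closes the
line by landing `ResidualBianchiDoorLevel_of_facts`, which takes them as its four hypotheses
(`proof.conditional`, the minimum possible trust base for E1′ as typed: card §Barriers).
[cite: KhareWintenberger2009, Thm. 1.2 and Thm. 9.1] [cite: ArthurClozelAMS120, Ch. 3 Thm. 4.2 (a), Thm. 5.1] -/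
theorem stub_namedFacts :
    (∀ (p : ℕ) [Fact p.Prime] (k : Type) [Field k] [TopologicalSpace k] [DiscreteTopology k],
      khare_wintenberger p k) ∧
    baseChange_cyclic_cuspidal ∧ ArthurClozel1989_strongLifting_archimedean ∧
    ArthurClozel1989_strongLifting_allFinite := by
  sorry

/-! ## Composition -/

/-- Two framed Galois representations with the same underlying group homomorphism are equal.
[folklore] -/
theorem framedGaloisRep_eq_of_toMonoidHom_eq {F : Type*} [Field F] {A : Type*} [CommRing A]
    [TopologicalSpace A] {n : ℕ} {σ τ : FramedGaloisRep F A n}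
    (h : σ.toMonoidHom = τ.toMonoidHom) : σ = τ :=
  ContinuousMonoidHom.ext fun g => by simpa using DFunLike.congr_fun h g

/-- **Composition (`ResidualBianchiDoorLevel` from the stubs)**: E1′ proved modulo the named facts
`khare_wintenberger` (all `p`, `k`), `baseChange_cyclic_cuspidal`,
`ArthurClozel1989_strongLifting_archimedean`, `ArthurClozel1989_strongLifting_allFinite`
(`stub_namedFacts`; the landed form takes them as hypotheses).
`stub_qLevel` gives `S ∋ 2` (primes), the entrywise model `σ₀ = GL₂(ι⁻¹) ∘ ρ` and the regular
algebraic cuspidal `π_ℚ` congruent to `σ₀` off `S`; for each imaginary quadratic 2-split `K`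
(`IsTotallyComplex` and the splitting of `2` are not used) the landed
`ResidualBianchiDoorMod2.exists_padicModel_restrictField` supplies the same `σ₀` (equal as framed
representations, `framedGaloisRep_eq_of_toMonoidHom_eq`) with `σ := σ₀|_{Γ_K}` entrywise `ι`-compatible
with `ρ|_{Γ_K}`, of finite image, irreducible, projectively `A₅`; `stub_cuspWitness` and
`stub_bcTransfer` give the regular algebraic cuspidal `π₀` on `GL₂(𝔸_K)` congruent to `σ` at every
place of `K` over no prime of `S`. -/
theorem ResidualBianchiDoorLevel_of :
    Summit.Langlands.Langlands.Theses.ParityBlindBianchi.ResidualBianchiDoorLevel := by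
  -- the four named facts (the hypotheses of the landed conditional theorem)
  obtain ⟨hKW, hBC, hArch, hR1⟩ := stub_namedFacts
  intro ι ρ hirr hA5
  obtain ⟨S, h2S, hS, σ₀, hσ₀, hcptQ, πQ, hRA, hgood⟩ := stub_qLevel hKW ι ρ hirr hA5
  refine ⟨S, h2S, ?_⟩
  intro K _ _ _htc hdeg _hsplit
  -- the Galois side: the same `σ₀`, restricted to `Γ_K`
  obtain ⟨σ₀', hσ₀', hfin, hproj, hmodel, hfinK, hirrK, hA5K⟩ :=
    Summit.Langlands.Langlands.Theorems.ResidualBianchiDoorMod2.exists_padicModel_restrictField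
      ι ρ hA5 K hdeg
  obtain rfl : σ₀' = σ₀ := framedGaloisRep_eq_of_toMonoidHom_eq (hσ₀'.trans hσ₀.symm)
  -- the automorphic side over `K`
  obtain ⟨hcpt, π₀, hRA₀, hgood₀⟩ := stub_bcTransfer hBC hArch hR1 ι σ₀' S hcptQ πQ hRA
    hgood K hdeg (stub_cuspWitness ι σ₀' hfin hproj S hS hcptQ πQ hgood K hdeg)
  exact ⟨σ₀'.restrictField K, hmodel, hfinK, hirrK, hA5K, hcpt, π₀, hRA₀, hgood₀⟩

end Summit.Langlands.Langlands.Cruxes.ResidualBianchiDoorLevel.Sketch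

end
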